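import Summits.ResolutionOfSingularities.ResolutionOfSingularities.Theorems.RadicialJungCleanResolvesReduction
import Summits.ResolutionOfSingularities.ResolutionOfSingularities.Theorems.RadicialJungCleanResolvesRegularTypeStalk
import Summits.ResolutionOfSingularities.ResolutionOfSingularities.Theorems.PAlterationPalterationThesisIffSummit
import Summits.ResolutionOfSingularities.ResolutionOfSingularities.Theorems.PAlterationPicoverOfDegP
import Literature.AlgebraicGeometry.Resolution.LogRegularNormal
import Summits.ResolutionOfSingularities.ResolutionOfSingularities.Theorems.RadicialJungCleanModelsSufficeNormalizeExponents
import Summits.ResolutionOfSingularities.ResolutionOfSingularities.Theorems.RadicialJungCleanModelsSufficeRegularTypeSop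
import Summits.ResolutionOfSingularities.ResolutionOfSingularities.Theorems.RadicialJungCleanModelsSufficeKummerOrderStructure
import Summits.ResolutionOfSingularities.ResolutionOfSingularities.Theorems.RadicialJungCleanModelsSufficeLogRegularAddFree
import Summits.ResolutionOfSingularities.ResolutionOfSingularities.Theorems.RadicialJungCleanModelsSufficeKummerOrderLogRegular
import Summits.ResolutionOfSingularities.ResolutionOfSingularities.Theorems.RadicialJungCleanModelsSufficeKummerMonoid
import Summits.ResolutionOfSingularities.ResolutionOfSingularities.Theorems.RadicialJungCleanModelsSufficeKummerOrderNonunitIdeal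
import Summits.ResolutionOfSingularities.ResolutionOfSingularities.Theorems.RadicialJungCleanModelsSufficeFrame
import Summits.ResolutionOfSingularities.ResolutionOfSingularities.Theorems.RadicialJungCleanModelsSufficeCharts

/-!
# Crux `CleanModelsSuffice` (stmt-ResolutionOfSingularities-15883), line `Sketch` — the REDUCTION theorem (sorry-free)

Route `ResolutionOfSingularities/RadicialJung`, crux `CleanModelsSuffice` (rank 4):
`∀ p prime, PIAlt_p → CleanModels_p → ResolutionInChar p`.

Composition (`CleanModelsSuffice_of`), conditional on two NAMED FACTS of Kato 1994 (absolute, no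
ground-field hypothesis — this is what lets the line reach EVERY field `k` of characteristic `p`):

1. FRAME (proved here from tree theorems): `ResolutionInChar p ⇐ PIAlt_p ∧ PICover_p`
   (`palterationThesisAt_iff_resolutionInChar`), `PICover_p ⇐ PicoverDegP_p` (degree-`p` tower at the
   fixed prime, `Picover.OfDegP.hasResolution_normalizationIn_of_finrank_eq_pow`), `PicoverDegP_p ⇐
   CleanModels_p ∧ CleanResolves`, `CleanResolves ⇐` its `π = 𝟙` case (`cleanResolves_of_self`).
2. `stub_exceptionalise` (the EXCEPTIONALISATION GAME, hardest stub, held by the lead): a pointwise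
   log-clean regular `V` has a further proper birational regular model `V' → V` carrying a GLOBAL
   boundary `D₁ … D_N` (closed subsets with global exponents `e_k`) to which log-clean presentations
   are ADAPTED at every point (toroidal charged directions `⊆ D`, transversal parameters transversal
   to `D`, exponents `≡ c_v · e` modulo `p`).
3. `stub_normalizeExponents`, `stub_kummerOrderStructure`, `stub_kummerOrderLogRegular`,
   `stub_regularTypeSop` (ring-level local algebra of the Kummer order
   `R = ⊕_{j<p} A · y^j / t^{⌊j a/p⌋}` and of regular-type points), `stub_charts` (pointwise Kato
   charts on the normalisation `V'^L`, compatible on overlaps) and `atlasOfCharts` (PROVED assembly of a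
   `LogAtlas` with `IsLogRegular`): an adapted model carries a log-regular Zariski fs atlas on `V'^L`.
4. Kato 1994 (10.4) (`Kato1994_logRegularScheme_hasResolution`, vendored) resolves `V'^L`; transport
   down `V'^L → V^L` (`hasResolution_normalizationIn_of_isBirational`, proved in tree).

Kato 1994 (4.1) (log regular ⇒ normal; stated below as a named fact) identifies the Kummer order
with the local rings of the normalisation.
-/

noncomputable section

set_option linter.dupNamespace false -- mandated namespace of this single-conjunct summit

open CategoryTheory CategoryTheory.Limits AlgebraicGeometry TopologicalSpace
open Literature.AlgebraicGeometry.Resolution Literature.AlgebraicGeometry.Motives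
open Summit.ResolutionOfSingularities.ResolutionOfSingularities.Theorems.Picover

universe u

namespace Summit.ResolutionOfSingularities.ResolutionOfSingularities.Theorems.RadicialJung.CleanModelsSuffice

-- Kato 1994 Thm (4.1) named fact: LANDED as Literature.AlgebraicGeometry.Resolution.Kato1994_logRegularLocal_isIntegrallyClosed (p131203)

/-! ## The reduction -/

/-- **Adapted models are resolved by Kato (log-regular normalisation).** Let `W` be integral, separated and of finite
type over a field `k` of characteristic `p`, `L / K(W)` purely inseparable of degree `p`, and `π : V ⟶ W` a proper
birational morphism from a regular integral `V` carrying PAIRWISE ADAPTED log-clean data for `L` along `π` (the output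
clause of the exceptionalisation game = the `hR` hypothesis of `stub_charts` transported along `π^♯ : K(W) ≅ K(V)`).
Then, granted Kato 1994 (10.4) and (4.1), the normalisation of `W` in `L` has a resolution: `stub_charts` + `atlasOfCharts`
make `V^L` a log-regular Zariski fs log scheme, Kato (10.4) resolves it, and the resolution descends along the proper
birational `V^L → W^L` (`CleanResolves.hasResolution_normalizationIn_of_isBirational`). [folklore] -/
theorem hasResolution_normalizationIn_of_adaptedModel
    (hK : Kato1994_logRegularScheme_hasResolution.{0})
    (hK4 : Kato1994_logRegularLocal_isIntegrallyClosed.{0})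
    (p : ℕ) (hp : p.Prime) (k : Type) [Field k] [CharP k p]
    (W : Scheme.{0}) [IsIntegral W] (f : W ⟶ Spec (.of k)) (L : Type) [Field L]
    [Algebra W.functionField L] [IsSeparated f] [LocallyOfFiniteType f] [QuasiCompact f]
    [IsPurelyInseparable W.functionField L] (hdeg : Module.finrank W.functionField L = p)
    (V : Scheme.{0}) (π : V ⟶ W) [IsIntegral V] [IsDominant π] [IsProper π]
    (hbir : IsBirational π) (hVreg : Scheme.IsRegular V)
    (hRv :

      ∃ (y : V → L) (g : V → W.functionField) (d r m : V → ℕ) (hrd : ∀ v, r v ≤ d v)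
        (hmr : ∀ v, m v ≤ r v) (t : ∀ v : V, Fin (d v) → V.presheaf.stalk v) (a : ∀ v : V, Fin (m v) → ℕ)
        (U : V → V.Opens) (hU : ∀ v, v ∈ U v) (s : ∀ v : V, Fin (r v) → Γ(V, U v)),
        (∀ v : V, y v ∉ Set.range (algebraMap W.functionField L) ∧
          algebraMap W.functionField L (g v) = y v ^ p ∧
          Ideal.span (Set.range (t v)) = IsLocalRing.maximalIdeal (V.presheaf.stalk v) ∧
          ringKrullDim (V.presheaf.stalk v) = (d v : WithBot ℕ∞) ∧
          (∀ i : Fin (r v), V.presheaf.germ (U v) v (hU v) (s v i) = t v (Fin.castLE (hrd v) i)) ∧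
          (∀ i : Fin (m v), ¬ p ∣ a v i) ∧
          ((0 < m v ∧ RatFn.functionFieldMap π (g v) = ∏ i : Fin (m v),
              (algebraMap (V.presheaf.stalk v) V.functionField
                (t v (Fin.castLE ((hmr v).trans (hrd v)) i))) ^ (a v i)) ∨
            (m v = 0 ∧ ∃ u₀ : V.presheaf.stalk v, IsUnit u₀ ∧
              RatFn.functionFieldMap π (g v) = algebraMap (V.presheaf.stalk v) V.functionField u₀ ∧
              ((∀ x : V.presheaf.stalk v, u₀ - x ^ p ∉ IsLocalRing.maximalIdeal (V.presheaf.stalk v)) ∨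
                (∃ x : V.presheaf.stalk v, u₀ - x ^ p ∈ IsLocalRing.maximalIdeal (V.presheaf.stalk v) ∧
                  u₀ - x ^ p ∉ IsLocalRing.maximalIdeal (V.presheaf.stalk v) ^ 2 ⊔
                    Ideal.span (Set.range fun i : Fin (r v) => t v (Fin.castLE (hrd v) i))))))) ∧
        (∀ (v w : V) (hw : w ∈ U v), ∃ (dw : ℕ) (tw : Fin dw → V.presheaf.stalk w) (ι : Fin (r v) → Fin dw),
          Ideal.span (Set.range tw) = IsLocalRing.maximalIdeal (V.presheaf.stalk w) ∧
          ringKrullDim (V.presheaf.stalk w) = (dw : WithBot ℕ∞) ∧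
          (∀ i : Fin (r v), V.presheaf.germ (U v) w hw (s v i) ∈ IsLocalRing.maximalIdeal (V.presheaf.stalk w) →
            tw (ι i) = V.presheaf.germ (U v) w hw (s v i)) ∧
          (∀ i j : Fin (r v), V.presheaf.germ (U v) w hw (s v i) ∈ IsLocalRing.maximalIdeal (V.presheaf.stalk w) →
            V.presheaf.germ (U v) w hw (s v j) ∈ IsLocalRing.maximalIdeal (V.presheaf.stalk w) → ι i = ι j → i = j)) ∧
        (∀ (v v' w : V) (hw : w ∈ U v) (hw' : w ∈ U v'), ∃ μ : ℕ, ¬ p ∣ μ ∧ ∀ i : Fin (r v),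
          V.presheaf.germ (U v) w hw (s v i) ∈ IsLocalRing.maximalIdeal (V.presheaf.stalk w) →
          ∃ i' : Fin (r v'), Associated (V.presheaf.germ (U v) w hw (s v i))
              (V.presheaf.germ (U v') w hw' (s v' i')) ∧
            ((i : ℕ) < m v ↔ (i' : ℕ) < m v') ∧
            (∀ (hi : (i : ℕ) < m v) (hi' : (i' : ℕ) < m v'), a v' ⟨i', hi'⟩ ≡ μ * a v ⟨i, hi⟩ [MOD p]))) :
    Scheme.HasResolution (normalizationIn W L) := by
  -- `π^♯ : K(W) ≅ K(V)`
  have hbij : Function.Bijective (RatFn.functionFieldMap π) :=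
    TowerTransport.bijective_functionFieldMap_of_isIso π hbir.isIso_stalkMap_genericPoint
  let eK : W.functionField ≃+* V.functionField := RingEquiv.ofBijective _ hbij
  have heK : ∀ x, eK x = RatFn.functionFieldMap π x := fun _ => rfl
  -- `L` as a `K(V)`-algebra
  letI : Algebra V.functionField L :=
    ((algebraMap W.functionField L).comp eK.symm.toRingHom).toAlgebra
  have halg : algebraMap V.functionField L =
      (algebraMap W.functionField L).comp eK.symm.toRingHom := rfl
  have hcompat : (algebraMap V.functionField L).comp (RatFn.functionFieldMap π) =
      algebraMap W.functionField L := by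
    refine RingHom.ext fun x => ?_
    rw [halg, RingHom.comp_apply, RingHom.comp_apply, ← heK]
    exact congrArg (algebraMap W.functionField L) (eK.symm_apply_apply x)
  have halg_apply : ∀ g : W.functionField,
      algebraMap V.functionField L (RatFn.functionFieldMap π g) = algebraMap W.functionField L g :=
    fun g => congrArg (fun φ : W.functionField →+* L => φ g) hcompat
  have hrange : Set.range (algebraMap V.functionField L) =
      Set.range (algebraMap W.functionField L) := by
    ext z
    constructor
    · rintro ⟨x, rfl⟩
      exact ⟨eK.symm x, by rw [halg]; rfl⟩
    · rintro ⟨x, rfl⟩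
      exact ⟨RatFn.functionFieldMap π x, halg_apply x⟩
  -- degree `p`, purely inseparable, characteristic `p`
  have hdeg' : Module.finrank V.functionField L = p := by
    rw [← hdeg]
    exact Algebra.finrank_eq_of_equiv_equiv eK.symm (RingEquiv.refl L) (by ext x; simp [halg])
  haveI : FiniteDimensional W.functionField L :=
    Module.finite_of_finrank_pos (by rw [hdeg]; exact hp.pos)
  haveI : FiniteDimensional V.functionField L :=
    Module.finite_of_finrank_pos (by rw [hdeg']; exact hp.pos)
  haveI : CharP W.functionField p := TowerTransport.charP_functionField W f
  haveI : CharP V.functionField p := TowerTransport.charP_functionField V (π ≫ f)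
  haveI : ExpChar W.functionField p := ExpChar.prime hp
  haveI : ExpChar V.functionField p := ExpChar.prime hp
  haveI : IsPurelyInseparable V.functionField L :=
    TowerTransport.isPurelyInseparable_of_ringEquiv_base (p := p) eK.symm halg.symm
  -- the chart assembly on `V^L`
  obtain ⟨hLN, ι, W', n, P, φ, hcov, hPfs, hreg, hcomp⟩ :=
    stub_charts hK4 stub_normalizeExponents stub_kummerOrderStructure stub_kummerOrderLogRegular
      stub_kummerOrderNonunitIdeal stub_logRegularAddFree stub_kummerMonoid stub_regularTypeSop p hp k V
      (π ≫ f) L hVreg hdeg' (by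
      obtain ⟨y, g, d, r, m, hrd, hmr, t, a, U, hU, s, hpt, hsop, hov⟩ := hRv
      refine ⟨y, fun v => RatFn.functionFieldMap π (g v), d, r, m, hrd, hmr, t, a, U, hU, s,
        fun v => ?_, hsop, hov⟩
      obtain ⟨hy, hg, hrest⟩ := hpt v
      refine ⟨?_, ?_, hrest⟩
      · rw [hrange]; exact hy
      · rw [halg_apply]; exact hg)
  -- Kato (10.4) on the log-regular atlas of `V^L`
  haveI : CompactSpace W := QuasiCompact.compactSpace_of_compactSpace f
  haveI : CompactSpace V := QuasiCompact.compactSpace_of_compactSpace π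
  haveI : IsFinite (normalizationInι V L) := isFinite_normalizationInι V L (π ≫ f)
  haveI : CompactSpace (normalizationIn V L) :=
    QuasiCompact.compactSpace_of_compactSpace (normalizationInι V L)
  obtain ⟨𝒜, h𝒜⟩ := atlasOfCharts (normalizationIn V L) hLN ι W' n P φ hcov hPfs hreg hcomp
  have hres' : Scheme.HasResolution (normalizationIn V L) := hK _ 𝒜 inferInstance h𝒜
  -- descend along `V^L → W^L`
  exact CleanResolves.hasResolution_normalizationIn_of_isBirational W f L V π hbir hcompat hres'

/-- **REDUCTION (sorry-free): the crux `CleanModelsSuffice` follows from Kato 1994 (10.4) and (4.1) and the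
exceptionalisation game.** This is the registered skeleton `Cruxes/CleanModelsSuffice/Lines/Sketch.lean` with its two
remaining stubs turned into hypotheses: `hK` = Kato 1994 (10.4) (`Kato1994_logRegularScheme_hasResolution`, named fact),
`hK4` = Kato 1994 (4.1) (`Kato1994_logRegularLocal_isIntegrallyClosed`, named fact), `hGame` = the registered statement
of `stub_exceptionalise` (a pointwise log-clean regular model has a further proper birational regular model with
PAIRWISE ADAPTED clean data). Everything else — the frame, the seven ring-level stubs, the chart assembly `stub_charts`,
the atlas `atlasOfCharts` — is PROVED in tree, so this records kernel-checked that the crux is closed modulo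
{Kato (10.4), Kato (4.1), the game}. [folklore] -/
theorem cleanModelsSuffice_of_kato_of_game
    (hK : Kato1994_logRegularScheme_hasResolution.{0})
    (hK4 : Kato1994_logRegularLocal_isIntegrallyClosed.{0})
    (hGame : ∀ (p : ℕ) (hp : p.Prime) (k : Type) [Field k] [CharP k p]
      (V : Scheme.{0}) [IsIntegral V] (f : V ⟶ Spec (.of k)) (L : Type) [Field L]
      [Algebra V.functionField L] [IsSeparated f] [LocallyOfFiniteType f] [QuasiCompact f]
      (hVreg : Scheme.IsRegular V) [IsPurelyInseparable V.functionField L]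
      (hdeg : Module.finrank V.functionField L = p)
      (hclean : ∀ v : V, ∃ (y : L) (g : V.functionField),
        y ∉ Set.range (algebraMap V.functionField L) ∧ algebraMap V.functionField L g = y ^ p ∧
        ((∃ (d m : ℕ) (hmd : m ≤ d) (t : Fin d → V.presheaf.stalk v) (a : Fin m → ℕ),
            Ideal.span (Set.range t) = IsLocalRing.maximalIdeal (V.presheaf.stalk v) ∧
            ringKrullDim (V.presheaf.stalk v) = (d : WithBot ℕ∞) ∧ 0 < m ∧ (∀ i, ¬ p ∣ a i) ∧
            g = ∏ i : Fin m,
              (algebraMap (V.presheaf.stalk v) V.functionField (t (Fin.castLE hmd i))) ^ (a i)) ∨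
          (∃ u₀ : V.presheaf.stalk v, IsUnit u₀ ∧
            g = algebraMap (V.presheaf.stalk v) V.functionField u₀ ∧
            ((∀ c : V.presheaf.stalk v,
                u₀ - c ^ p ∉ IsLocalRing.maximalIdeal (V.presheaf.stalk v)) ∨
              (∃ c : V.presheaf.stalk v,
                u₀ - c ^ p ∈ IsLocalRing.maximalIdeal (V.presheaf.stalk v) ∧
                u₀ - c ^ p ∉ IsLocalRing.maximalIdeal (V.presheaf.stalk v) ^ 2))))),
      ∃ (V' : Scheme.{0}) (π' : V' ⟶ V) (_ : IsIntegral V') (_ : IsDominant π'),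
        IsProper π' ∧ IsBirational π' ∧ Scheme.IsRegular V' ∧
        ∃ (y : V' → L) (g : V' → V.functionField) (d r m : V' → ℕ) (hrd : ∀ v, r v ≤ d v)
          (hmr : ∀ v, m v ≤ r v) (t : ∀ v : V', Fin (d v) → V'.presheaf.stalk v) (a : ∀ v : V', Fin (m v) → ℕ)
          (U : V' → V'.Opens) (hU : ∀ v, v ∈ U v) (s : ∀ v : V', Fin (r v) → Γ(V', U v)),
          (∀ v : V', y v ∉ Set.range (algebraMap V.functionField L) ∧
            algebraMap V.functionField L (g v) = y v ^ p ∧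
            Ideal.span (Set.range (t v)) = IsLocalRing.maximalIdeal (V'.presheaf.stalk v) ∧
            ringKrullDim (V'.presheaf.stalk v) = (d v : WithBot ℕ∞) ∧
            (∀ i : Fin (r v), V'.presheaf.germ (U v) v (hU v) (s v i) = t v (Fin.castLE (hrd v) i)) ∧
            (∀ i : Fin (m v), ¬ p ∣ a v i) ∧
            ((0 < m v ∧ RatFn.functionFieldMap π' (g v) = ∏ i : Fin (m v),
                (algebraMap (V'.presheaf.stalk v) V'.functionField
                  (t v (Fin.castLE ((hmr v).trans (hrd v)) i))) ^ (a v i)) ∨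
              (m v = 0 ∧ ∃ u₀ : V'.presheaf.stalk v, IsUnit u₀ ∧
                RatFn.functionFieldMap π' (g v) = algebraMap (V'.presheaf.stalk v) V'.functionField u₀ ∧
                ((∀ x : V'.presheaf.stalk v, u₀ - x ^ p ∉ IsLocalRing.maximalIdeal (V'.presheaf.stalk v)) ∨
                  (∃ x : V'.presheaf.stalk v, u₀ - x ^ p ∈ IsLocalRing.maximalIdeal (V'.presheaf.stalk v) ∧
                    u₀ - x ^ p ∉ IsLocalRing.maximalIdeal (V'.presheaf.stalk v) ^ 2 ⊔
                      Ideal.span (Set.range fun i : Fin (r v) => t v (Fin.castLE (hrd v) i))))))) ∧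
          (∀ (v w : V') (hw : w ∈ U v), ∃ (dw : ℕ) (tw : Fin dw → V'.presheaf.stalk w) (ι : Fin (r v) → Fin dw),
            Ideal.span (Set.range tw) = IsLocalRing.maximalIdeal (V'.presheaf.stalk w) ∧
            ringKrullDim (V'.presheaf.stalk w) = (dw : WithBot ℕ∞) ∧
            (∀ i : Fin (r v), V'.presheaf.germ (U v) w hw (s v i) ∈ IsLocalRing.maximalIdeal (V'.presheaf.stalk w) →
              tw (ι i) = V'.presheaf.germ (U v) w hw (s v i)) ∧
            (∀ i j : Fin (r v), V'.presheaf.germ (U v) w hw (s v i) ∈ IsLocalRing.maximalIdeal (V'.presheaf.stalk w) →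
              V'.presheaf.germ (U v) w hw (s v j) ∈ IsLocalRing.maximalIdeal (V'.presheaf.stalk w) → ι i = ι j → i = j)) ∧
          (∀ (v v' w : V') (hw : w ∈ U v) (hw' : w ∈ U v'), ∃ μ : ℕ, ¬ p ∣ μ ∧ ∀ i : Fin (r v),
            V'.presheaf.germ (U v) w hw (s v i) ∈ IsLocalRing.maximalIdeal (V'.presheaf.stalk w) →
            ∃ i' : Fin (r v'), Associated (V'.presheaf.germ (U v) w hw (s v i))
                (V'.presheaf.germ (U v') w hw' (s v' i')) ∧
              ((i : ℕ) < m v ↔ (i' : ℕ) < m v') ∧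
              (∀ (hi : (i : ℕ) < m v) (hi' : (i' : ℕ) < m v'), a v' ⟨i', hi'⟩ ≡ μ * a v ⟨i, hi⟩ [MOD p]))) :
    Summit.ResolutionOfSingularities.ResolutionOfSingularities.Theses.RadicialJung.CleanModelsSuffice := by
  -- (1) the `π = 𝟙` case of `CleanResolves`
  have hSelf : ∀ p : ℕ, p.Prime → ∀ (k : Type) [Field k] [CharP k p] (V : Scheme.{0}) [IsIntegral V]
      (f : V ⟶ Spec (.of k)) (L : Type) [Field L] [Algebra V.functionField L],
      IsSeparated f → LocallyOfFiniteType f → QuasiCompact f → Scheme.IsRegular V →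
      IsPurelyInseparable V.functionField L → Module.finrank V.functionField L = p →
      (∀ v : V, ∃ (y : L) (g : V.functionField), y ∉ Set.range (algebraMap V.functionField L) ∧
        algebraMap V.functionField L g = y ^ p ∧
        ((∃ (d m : ℕ) (hmd : m ≤ d) (t : Fin d → V.presheaf.stalk v) (a : Fin m → ℕ),
            Ideal.span (Set.range t) = IsLocalRing.maximalIdeal (V.presheaf.stalk v) ∧
            ringKrullDim (V.presheaf.stalk v) = (d : WithBot ℕ∞) ∧ 0 < m ∧ (∀ i, ¬ p ∣ a i) ∧
            g = ∏ i : Fin m,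
              (algebraMap (V.presheaf.stalk v) V.functionField (t (Fin.castLE hmd i))) ^ (a i)) ∨
          (∃ u₀ : V.presheaf.stalk v, IsUnit u₀ ∧
            g = algebraMap (V.presheaf.stalk v) V.functionField u₀ ∧
            ((∀ c : V.presheaf.stalk v,
                u₀ - c ^ p ∉ IsLocalRing.maximalIdeal (V.presheaf.stalk v)) ∨
              (∃ c : V.presheaf.stalk v,
                u₀ - c ^ p ∈ IsLocalRing.maximalIdeal (V.presheaf.stalk v) ∧
                u₀ - c ^ p ∉ IsLocalRing.maximalIdeal (V.presheaf.stalk v) ^ 2))))) →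
      Scheme.HasResolution (normalizationIn V L) := by
    intro p hp k _ _ V _ f L _ _ hsep hloc hqc hVreg hPI hdeg hclean
    haveI := hsep; haveI := hloc; haveI := hqc; haveI := hPI
    obtain ⟨V', π', hV'int, hdom, hprop, hbir, hV'reg, hRv⟩ :=
      hGame p hp k V f L hVreg hdeg hclean
    haveI := hV'int; haveI := hdom; haveI := hprop
    exact hasResolution_normalizationIn_of_adaptedModel hK hK4 p hp k V f L hdeg V' π' hbir hV'reg hRv
  -- (2) `CleanResolves` from its `π = 𝟙` case (proved in tree)
  have hCR : Summit.ResolutionOfSingularities.ResolutionOfSingularities.Theses.RadicialJung.CleanResolves :=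
    CleanResolves.cleanResolves_of_self hSelf
  -- (3) the frame at the fixed prime
  intro p hp hPI hCM
  have hDegP : ∀ (k : Type) [Field k] [CharP k p] (W : Scheme.{0}) [IsIntegral W]
      (f : W ⟶ Spec (.of k)) (L : Type) [Field L] [Algebra W.functionField L],
      IsSeparated f → LocallyOfFiniteType f → QuasiCompact f → Scheme.IsRegular W →
      IsPurelyInseparable W.functionField L → Module.finrank W.functionField L = p →
      Scheme.HasResolution (normalizationIn W L) := by
    intro k _ _ W _ f L _ _ hs hl hq hr hpi hd
    obtain ⟨V, π, hVi, hdom, hV⟩ := hCM k W f L hs hl hq hr hpi hd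
    exact hCR p hp k W f L hs hl hq hr hpi hd V π hV
  exact (palterationThesisAt_iff_resolutionInChar p hp).mp ⟨hPI, picoverAt_of_degPAt p hp hDegP⟩

end Summit.ResolutionOfSingularities.ResolutionOfSingularities.Theorems.RadicialJung.CleanModelsSuffice

end
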